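import Summits.FinalStateConjecture.FinalStateConjecture.Theses.BartnikGapSettling
import Summits.FinalStateConjecture.FinalStateConjecture.Theorems.BartnikGapSettlingBondiBartnikRigidityTrivialRegime
import Literature.Geometry.Lorentzian.BondiBartnikGap
import Literature.Geometry.Lorentzian.CausalFutureProofs
import Literature.Geometry.Lorentzian.DeviationTolerance

/-!
# Line `hyperboloidal-mass-pinches-flat` for crux `BondiBartnikRigidity` (stmt-FinalStateConjecture-10807)

Crux-plan skeleton (planner, 2026-08-16) for the idea card
`Cruxes/BondiBartnikRigidity/Ideas/hyperboloidal-mass-pinches-flat.md` (triage r1: 3/3 pass; sharpenings: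
rebase the engine on `Λ < 1`, let it spend `k' ≥ k + 3`, file the escape-window existence as the first stub,
thread the frame bookkeeping of `HasCutBondiMass` energies through the engine).

## Shape

The crux decl is FIXED (route `BartnikGapSettling`, rev 2).  Its honest content is the repaired regime C″ of
`Lines/SketchRepairedStatement.lean` (lead c1): `Λ < 1` (below `‖η‖_op = 1` the flat chart is honest,
`Literature/Geometry/Lorentzian/DeviationTolerance.lean`), `N ≤ 1`, and `p` in the collar slab when `N = 1`.
The skeleton therefore has three layers:

* **this line (N = 0 sector of C″)** — `stub_probeBartnikMassZero` (B1: the Bondi–Bartnik infimum of a point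
  is `0`, so "gap ≤ γ" is "own cut energy ≤ 3γ"), `stub_escapeWindowLeaf` (F3: an honest bounded-geometry
  hyperboloid `S₁ ⊆ J⁺(p)` exists — the slice on which radiation escaping before `u_p` is provably absent),
  `stub_hyperboloidalMassPinchesFlat` (B2, the engine: on such an `S₁` the vacuum spacetime-harmonic mass
  identity turns "cut energy ≤ γ" into weighted `L²`-smallness of the spacetime Hessian, bubbles are priced out
  by `Λ₁`, interpolation against `k₁` derivatives gives the `(ε, k)`-flat chart); glued by
  `J⁺(S₁) ⊆ J⁺(J⁺{p}) = J⁺{p} ⊆ J⁺(S)` (`LorentzianMetric.causalFuture_causalFuture_eq`, proved in tree);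
* **foreign sector (N = 1, p ∈ collar, Λ < 1)** — `stub_collarSectorGap`, verbatim the `N = 1` sector of C″ in
  gap form; it belongs to the lines `core-cone-calibration` / `two-cones-one-sphere` (this line's contribution
  there — far-zone pinning by the same identity with an inner Hawking-mass boundary term, card §4 — is a graft
  for that line's lead, not a stub here);
* **filed-text residue** — `stub_filedTextResidue`: the sectors of the FILED decl outside C″
  (`1 ≤ Λ`, or `2 ≤ N`, or `N = 1 ∧ p ∉ collar`).  NOT a lemma of the line: it is false on paper in the
  junk-chart regime (lead dossiers `Lines/Sketch-dead.md`, `Lines/Sketch-dead-c1.md` §2.3 W2; item note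
  `verdict: misstated` 2026-08-16T12:57Z) and is exactly what the pending restatement deletes; isolated in ONE
  stub so that nothing else in this file quantifies over `Λ ≥ 1` (the defect that killed `Lines/Sketch.lean`).
  Do not staff it.

The trivial regime `Λ ≤ ε` is the landed theorem `Theorems.stub_trivialRegime` (p103152), imported.

Composition `BondiBartnikRigidity_of` is pure logic (sorry-free): `k'` = max of the stubs' derivative counts,
`δ, γ` = minima at the given `Λ`, case split `Λ ≤ ε` / `ε < Λ < 1` (then on `N ∈ {0, 1, ≥ 2}` and, for `N = 1`,
on `p ∈ collar`) / `1 ≤ Λ`.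

Disproof used: none available (no `Disproof.lean` / landed `Negative/` lemma for this crux on 2026-08-16;
`ledger crux ls`).  Negatives index (`ledger negatives --problem FinalStateConjecture`): one unrelated entry
(`not_UniformPhotonSphereChannels`); no stub restates it.
-/

noncomputable section

-- D-0017: single-problem summit, `Summit.<S>.<S>.…` by design (cf. lakefile `weak.linter.dupNamespace`).
set_option linter.dupNamespace false

open Set Filter Function Topology TopologicalSpace
open Literature.Geometry.Lorentzian
open scoped Manifold ContDiff Topology ENNReal BigOperators

namespace Summit.FinalStateConjecture.FinalStateConjecture.Cruxes.BondiBartnikRigidity.HyperboloidalMassPinchesFlat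

/-! ## Stubs of the line (N = 0 sector) -/

/-- **B1 — the Bondi–Bartnik infimum of a point is zero** (`ProbeBartnikMassZero` of the card; Λ-free,
`k'`-free).  On an MGHD of admissible vacuum data, a point `p ∈ J⁺(ι X)` has competitors of arbitrarily small
cut energy: shrink the competing neighbourhood to a Cauchy ball of radius `r` around `p` (vacuum small-sphere
Bartnik data, mass `O(r⁵)` — Wiygul, CMP 358 (2018), doi:10.1007/s00220-017-3005-8), extend it by a
Czimek-type small-data extension (arXiv:1609.08814) and a Corvino–Schoen far field to one-ended admissible data
of ADM mass `≤ η`, take its MGHD; by positivity/mass loss at `𝓘⁺` of the Christodoulou–Klainerman development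
(PMS 41, Ch. 17) the image point's cut energy is `≤ ADM ≤ η`.  `IsCompetitor` only needs an isometric
time-oriented open embedding of a neighbourhood of `p` (`IsCompetitor.restrict`).  Why plausibly true: every
step is in print for its own setting; the only transplant is reading CK's `M(u) ≤ M_ADM` at the cut of a
point.  Size: L.  Honours: REVIEW N1 ("N = 0 branch needs β_B({p}) = 0"). -/
theorem stub_probeBartnikMassZero :
    ∀ (X : Type) [TopologicalSpace X] [ChartedSpace E3 X] [IsManifold (𝓡 3) ∞ X]
      [T2Space X] [SecondCountableTopology X] [ConnectedSpace X],
    ∀ D ∈ admissibleVacuumData X, ∀ (𝒟 : VacuumCauchyDevelopment D) (p : 𝒟.carrier),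
    𝒟.IsMaximal → p ∈ 𝒟.metric.causalFuture 𝒟.timeOrientation (range 𝒟.embed) →
    ∀ η : ℝ, 0 < η → ∃ m' : ℝ, 𝒟.IsCompetitorMass ({p} : Set 𝒟.carrier) m' ∧ m' ≤ η := by
  sorry

/-- **F3 — the escape window** (first stub by triage r1-2/r1-3; shared by every `N = 0` engine).  Below the
honesty threshold (`Λ < 1`) a `(Λ, k')`-hyperboloid `S ∋ p` without holes, in an MGHD whose cone cut at `p`
has an energy `≤ γ`, is followed INSIDE `J⁺(p)` by an honest bounded-geometry hyperboloid: some
`(Λ₁, k₁)`-leaf `S₁ ⊆ J⁺({p})` with `Λ₁ < 1` (not small).  This is where all the dynamics of the sector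
lives: `J⁺(p)` is the region the gap sees (everything not radiated before `u_p` is counted in the cut energy, so
no collapse happens there: a hole of mass `μ` would cost `μ` of the `≤ γ` budget and, at unit scale, violate
`Λ₁`), but reaching it from `S` means evolving past whatever escapes before `u_p` — finite hyperboloidal time
`~2` in the frame in which `p` is the apex of `S`, longer (or a boosted re-charting of `S`) when `p` sits far
out on `S`.  Why it might fail / what it costs: no large-data semi-global existence theorem near `𝓘⁺` covers
honest-but-not-small outgoing content (Klainerman–Nicolò 2003 need weighted smallness; barrier
`NullConditionFailure` evasion (i): Bianchi/double-null formulation); truth is protected by the hypothesis that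
`p`'s whole cone reaches infinity with round sections (`HasCutBondiMass {p} m`).  `k' = k₁ + O(1)` (finite-time
loss), `Λ₁` may depend on `Λ` only.  Size: XL.  Sources: KlainermanNicolo2003; ChristodoulouKlainerman1993PMS41
Ch. 17; Ringstrom2009 (Cauchy stability); DeviationTolerance.lean (why `Λ, Λ₁ < 1`). -/
theorem stub_escapeWindowLeaf : ∀ (k₁ : ℕ), ∃ k' : ℕ, ∀ Λ : ℝ≥0∞, Λ < 1 →
    ∃ (Λ₁ : ℝ≥0∞) (γ : ℝ), Λ₁ < 1 ∧ 0 < γ ∧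
    ∀ (X : Type) [TopologicalSpace X] [ChartedSpace E3 X] [IsManifold (𝓡 3) ∞ X]
      [T2Space X] [SecondCountableTopology X] [ConnectedSpace X],
    ∀ D ∈ admissibleVacuumData X, ∀ (𝒟 : VacuumCauchyDevelopment D) (M a : Fin 0 → ℝ)
      (S : Set 𝒟.carrier) (p : 𝒟.carrier) (m : ℝ),
    𝒟.IsMaximal → 𝒟.toCauchyDevelopment.IsNearKerrLeaf k' Λ 0 M a S → p ∈ S →
    𝒟.toCauchyDevelopment.HasCutBondiMass ({p} : Set 𝒟.carrier) m → m ≤ γ →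
    ∃ S₁ : Set 𝒟.carrier, 𝒟.toCauchyDevelopment.IsNearKerrLeaf k₁ Λ₁ 0 M a S₁ ∧
      S₁ ⊆ 𝒟.metric.causalFuture 𝒟.timeOrientation ({p} : Set 𝒟.carrier) := by
  sorry

/-- **B2 — small cut energy pinches an honest hyperboloid flat** (the engine, `HyperboloidalMassStability` of the
card rebased on `Λ₁ < 1` as triage asked; the HARDEST stub).  For an honest `(Λ₁, k₁)`-hyperboloid
`S₁ ⊆ J⁺(p)` without holes in an MGHD of admissible vacuum data, an energy `m ≤ γ` of the cut of `p`'s cone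
forces an `(ε, k)`-flat leaf in `J⁺(S₁)` (`k₁ ≥ k + 3` is the stub's to choose; `γ = γ(k, ε, Λ₁)`).  Mechanism:
Bondi mass loss from the cut of `p` to the (later) cut of `S₁` and the Chruściel–Jezierski–Łęski identification
give hyperbolic energy `≤ γ` on `S₁`; the spacetime-harmonic mass formula of Hirsch–Kazaras–Khuri
(arXiv:2002.01534; hyperboloidal: Bray–Hirsch–Kazaras–Khuri–Zhang arXiv:2102.11421 §§6–7) has, in VACUUM, no
indefinite term (`μ = J = 0`), so `(1/16π) ∫_{S₁} |∇̄∇̄u|²/|∇u| ≤ γ`; Dong–Song bubbles (arXiv:2302.07414) are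
priced out by `Λ₁` at unit scale; Gagliardo–Nirenberg against the `C^{k₁}` bound gives `C^{k+1}`-smallness of
`(g, K)` on `S₁` relative to the unit hyperboloid of Minkowski, and a harmonic/CMC-adapted re-charting of (a
leaf just above) `S₁` is the `(ε, k)`-flat chart (template: Kazaras–Khuri–Lee arXiv:2111.05202, bounded
geometry + harmonic level sets ⇒ quantitative stability).  Why it might fail: (F2) `HasCutBondiMass {p} m` is an
ENERGY in the frame of the round family, while `S₁`'s chart frame is arbitrary — the boundary term of the
hyperboloidal identity on `S₁` is the energy in `S₁`'s frame, larger by the relative Doppler factor; the proof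
needs a frame dichotomy (large relative rapidity makes `S₁`-hard content `U`-expensive) or a witness leaf in the
family's frame; check first on boosted Schwarzschild hyperboloids that the identity returns `γ_v M` two-sidedly.
Also needs the hyperboloidal HKK identity with only CK weak peeling at the cut (definition request D-hyp of the
card: hyperbolic mass of an asymptotically hyperboloidal end + CJL identification as a named fact).  Size: XL.
Sources: HirschKazarasKhuri2022 (arXiv:2002.01534), arXiv:2102.11421, arXiv:2403.15984 (E = |P| rigidity),
ChruscielJezierskiLeski2004, DongSong2024, arXiv:2111.05202, doi:10.1007/s10714-017-2291-y. -/
theorem stub_hyperboloidalMassPinchesFlat : ∀ (k : ℕ) (ε : ℝ≥0∞), 0 < ε → ∃ k₁ : ℕ,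
    ∀ Λ₁ : ℝ≥0∞, Λ₁ < 1 → ∃ γ : ℝ, 0 < γ ∧
    ∀ (X : Type) [TopologicalSpace X] [ChartedSpace E3 X] [IsManifold (𝓡 3) ∞ X]
      [T2Space X] [SecondCountableTopology X] [ConnectedSpace X],
    ∀ D ∈ admissibleVacuumData X, ∀ (𝒟 : VacuumCauchyDevelopment D) (M a : Fin 0 → ℝ)
      (S₁ : Set 𝒟.carrier) (p : 𝒟.carrier) (m : ℝ),
    𝒟.IsMaximal → 𝒟.toCauchyDevelopment.IsNearKerrLeaf k₁ Λ₁ 0 M a S₁ →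
    S₁ ⊆ 𝒟.metric.causalFuture 𝒟.timeOrientation ({p} : Set 𝒟.carrier) →
    𝒟.toCauchyDevelopment.HasCutBondiMass ({p} : Set 𝒟.carrier) m → m ≤ γ →
    ∃ S' : Set 𝒟.carrier, 𝒟.toCauchyDevelopment.IsNearKerrLeaf k ε 0 M a S' ∧
      S' ⊆ 𝒟.metric.causalFuture 𝒟.timeOrientation S₁ := by
  sorry

/-! ## Foreign sector (N = 1, p in the collar) -/

/-- **Collar sector of the repaired crux, gap form** (FOREIGN: owned by lines `core-cone-calibration` /
`two-cones-one-sphere`; stated here only so that the composition reaches the filed decl).  Below the honesty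
threshold, a `(Λ, k')`-leaf through ONE `δ`-Kerr thick collar containing `p`, whose collar core has a cut energy
and Bondi–Bartnik gap `≤ γ`, is followed by an `(ε, k)`-near-Kerr leaf with the same `(M, a)` in `J⁺(S)`.  Why it
might fail: needs coercivity (not just sign) of the second variation of the cone flux at Kerr for supports in
`{r ≥ 3M}` and the calibration `β_B(thick Kerr collar) = M` (a null Penrose inequality with angular momentum,
open beyond arXiv:1506.06400); see those lines' cards.  This line's own contribution to the sector (far-zone
pinning by the mass identity on `{r ≥ R}` with inner Hawking-mass boundary term, card §4) is to be grafted as a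
split by that line's lead.  Size: XL (open problem).  Sources: HollandsWald2012, arXiv:1506.06400, HuangLee2020,
Bartnik2002ICM. -/
theorem stub_collarSectorGap : ∀ (χ m₀ : ℝ) (k : ℕ) (ε : ℝ≥0∞), χ < 1 → 0 < m₀ → 0 < ε →
    ∃ k' : ℕ, ∀ Λ : ℝ≥0∞, Λ < 1 → ε < Λ → ∃ (δ : ℝ≥0∞) (γ : ℝ), 0 < δ ∧ 0 < γ ∧
    ∀ (X : Type) [TopologicalSpace X] [ChartedSpace E3 X] [IsManifold (𝓡 3) ∞ X]
      [T2Space X] [SecondCountableTopology X] [ConnectedSpace X],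
    ∀ D ∈ admissibleVacuumData X, ∀ (𝒟 : VacuumCauchyDevelopment D)
      (M a : Fin 1 → ℝ) (S : Set 𝒟.carrier) (p : 𝒟.carrier) (mo' : Fin 1 → lorentzGroup × E4)
      (B' : Fin 1 → ModelBackground) (Φ : ∀ i, (B' i).domain → 𝒟.carrier),
    𝒟.IsMaximal → (∀ i, m₀ ≤ M i ∧ M i ≤ m₀⁻¹ ∧ |a i| ≤ χ * M i) →
    𝒟.toCauchyDevelopment.IsNearKerrLeaf k' Λ 1 M a S → p ∈ S →
    (∃ i, p ∈ Φ i '' (B' i).truncTimeSlab (3 * M i) 0) →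
    (∀ i, B' i = starBackground (mo' i).1 (mo' i).2 (M i) (a i)
      (fun x => Kerr.radius (a i) (poincareInv (mo' i).1 (mo' i).2 x))) →
    (∀ i, ContMDiffOn 𝓘(ℝ, E4) (𝓡 4) ∞ (Φ i)
        {x | -1 < (B' i).time x.1 ∧ (B' i).time x.1 < 1 ∧ (B' i).radius x.1 < 3 * M i + 1} ∧
      Topology.IsOpenEmbedding ({x | -1 < (B' i).time x.1 ∧ (B' i).time x.1 < 1 ∧
        (B' i).radius x.1 < 3 * M i + 1}.restrict (Φ i))) →
    (∀ i, 𝒟.toSpacetime.truncDeviationCk (B' i) (Φ i) k' (3 * M i) 0 ≤ δ) →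
    (∀ i, Φ i '' (B' i).truncTimeSlab (3 * M i) 0 ⊆ S) →
    (∃ m : ℝ, 𝒟.toCauchyDevelopment.HasCutBondiMass
      ({p} ∪ ⋃ i, Φ i '' (B' i).truncTimeSlab (3 * M i) 0) m) →
    𝒟.BondiBartnikGapLE ({p} ∪ ⋃ i, Φ i '' (B' i).truncTimeSlab (3 * M i) 0) γ →
    ∃ S' : Set 𝒟.carrier, 𝒟.toCauchyDevelopment.IsNearKerrLeaf k ε 1 M a S' ∧
      S' ⊆ 𝒟.metric.causalFuture 𝒟.timeOrientation S := by
  sorry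

/-! ## Filed-text residue (not a lemma of the line) -/

/-- **FILED-TEXT RESIDUE — do not staff.**  The sectors of the crux AS FILED (rev 2, `∀ Λ < ⊤`, any `N`, any
`p ∈ S`) that lie outside the repaired regime C″ of `Lines/SketchRepairedStatement.lean`: the junk-chart regime
`1 ≤ Λ` (for `Λ ≥ ‖η‖_op = 1` the flat-chart clause of `IsNearKerrLeaf` is met by collapsed charts,
`Spacetime.deviationCk_hypBackground_top_le`, so the leaf hypothesis certifies nothing and the `N = 0` sector is
defeated on paper by a high-frequency low-energy pulse train, dossier c1 §2.3 W2), the multi-collar sectors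
`2 ≤ N` (seamed cores carry no cut energy, BN1 / Defect B — vacuous except for stacked same-hole charts,
Defect C), and `N = 1` with `p` off the collar (seamed again).  It is stated verbatim as the filed crux
restricted to that regime (gap clause in the definitional form `BondiBartnikGapLE`), so that (i) the composition
below reaches the filed decl by pure logic, and (ii) the tenure restatement to C″ deletes exactly this stub and
nothing else in the file.  Known FALSE on paper in the `1 ≤ Λ` branch (item note `verdict: misstated`,
2026-08-16T12:57Z; `Lines/Sketch-dead.md`, `Lines/Sketch-dead-c1.md`); no formal refutation exists (no
constructible admissible MGHD in tree).  Size: n/a. -/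
theorem stub_filedTextResidue : ∀ (χ m₀ : ℝ) (N₀ k : ℕ) (ε : ℝ≥0∞), χ < 1 → 0 < m₀ → 0 < ε →
    ∃ k' : ℕ, ∀ Λ : ℝ≥0∞, Λ < ⊤ → ε < Λ → ∃ (δ : ℝ≥0∞) (γ : ℝ), 0 < δ ∧ 0 < γ ∧
    ∀ (X : Type) [TopologicalSpace X] [ChartedSpace E3 X] [IsManifold (𝓡 3) ∞ X]
      [T2Space X] [SecondCountableTopology X] [ConnectedSpace X],
    ∀ D ∈ admissibleVacuumData X, ∀ (𝒟 : VacuumCauchyDevelopment D) (N : ℕ)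
      (M a : Fin N → ℝ) (S : Set 𝒟.carrier) (p : 𝒟.carrier) (mo' : Fin N → lorentzGroup × E4)
      (B' : Fin N → ModelBackground) (Φ : ∀ i, (B' i).domain → 𝒟.carrier),
    (1 ≤ Λ ∨ 2 ≤ N ∨ (N = 1 ∧ ∀ i, p ∉ Φ i '' (B' i).truncTimeSlab (3 * M i) 0)) →
    𝒟.IsMaximal → N ≤ N₀ → (∀ i, m₀ ≤ M i ∧ M i ≤ m₀⁻¹ ∧ |a i| ≤ χ * M i) →
    𝒟.toCauchyDevelopment.IsNearKerrLeaf k' Λ N M a S → p ∈ S →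
    (∀ i, B' i = starBackground (mo' i).1 (mo' i).2 (M i) (a i)
      (fun x => Kerr.radius (a i) (poincareInv (mo' i).1 (mo' i).2 x))) →
    (∀ i, ContMDiffOn 𝓘(ℝ, E4) (𝓡 4) ∞ (Φ i)
        {x | -1 < (B' i).time x.1 ∧ (B' i).time x.1 < 1 ∧ (B' i).radius x.1 < 3 * M i + 1} ∧
      Topology.IsOpenEmbedding ({x | -1 < (B' i).time x.1 ∧ (B' i).time x.1 < 1 ∧
        (B' i).radius x.1 < 3 * M i + 1}.restrict (Φ i))) →
    (∀ i, 𝒟.toSpacetime.truncDeviationCk (B' i) (Φ i) k' (3 * M i) 0 ≤ δ) →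
    (∀ i, Φ i '' (B' i).truncTimeSlab (3 * M i) 0 ⊆ S) →
    Pairwise (Function.onFun Disjoint fun i => Φ i '' (B' i).truncTimeSlab (3 * M i) 0) →
    (∃ m : ℝ, 𝒟.toCauchyDevelopment.HasCutBondiMass
      ({p} ∪ ⋃ i, Φ i '' (B' i).truncTimeSlab (3 * M i) 0) m) →
    𝒟.BondiBartnikGapLE ({p} ∪ ⋃ i, Φ i '' (B' i).truncTimeSlab (3 * M i) 0) γ →
    ∃ S' : Set 𝒟.carrier, 𝒟.toCauchyDevelopment.IsNearKerrLeaf k ε N M a S' ∧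
      S' ⊆ 𝒟.metric.causalFuture 𝒟.timeOrientation S := by
  sorry

/-! ## Composition -/

/-- **The line closes the crux** (pure logic, sorry-free outside the stubs).  `k'` is the maximum of the
stubs' derivative counts (and `k`), `δ`/`γ` the minima of their tolerances at the given `Λ`; regimes:
`Λ ≤ ε` — the landed trivial regime (p103152); `ε < Λ < 1` — by cases on `N`: `N = 0` is THIS LINE
(`stub_probeBartnikMassZero` turns the gap into "own cut energy ≤ γ⋆", `stub_escapeWindowLeaf` gives the honest
hyperboloid `S₁ ⊆ J⁺{p}`, `stub_hyperboloidalMassPinchesFlat` the `(ε, k)`-flat leaf `S' ⊆ J⁺(S₁)`, and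
`J⁺(S₁) ⊆ J⁺(J⁺{p}) = J⁺{p} ⊆ J⁺(S)` by the tree's `causalFuture_causalFuture_eq`), `N = 1` with `p` in the
collar is the foreign `stub_collarSectorGap`, everything else is the filed-text residue; `1 ≤ Λ` — residue. -/
theorem BondiBartnikRigidity_of :
    Summit.FinalStateConjecture.FinalStateConjecture.Theses.BartnikGapSettling.BondiBartnikRigidity := by
  intro χ m₀ N₀ k ε hχ hm₀ hε
  -- derivative counts of the stubs
  obtain ⟨kᵣ, hR⟩ := stub_filedTextResidue χ m₀ N₀ k ε hχ hm₀ hε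
  obtain ⟨k₁, hP⟩ := stub_hyperboloidalMassPinchesFlat k ε hε
  obtain ⟨k₄, hW⟩ := stub_escapeWindowLeaf k₁
  obtain ⟨k₆, hC⟩ := stub_collarSectorGap χ m₀ k ε hχ hm₀ hε
  set k' : ℕ := max (max k kᵣ) (max k₄ k₆) with hk'
  have hkk' : k ≤ k' := by omega
  have hkᵣ : kᵣ ≤ k' := by omega
  have hk₄ : k₄ ≤ k' := by omega
  have hk₆ : k₆ ≤ k' := by omega
  refine ⟨k', fun Λ hΛ => ?_⟩
  by_cases hΛε : Λ ≤ ε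
  · -- trivial regime: the hypothesis leaf itself (landed, p103152)
    refine ⟨1, 1, one_pos, one_pos, ?_⟩
    intro X _ _ _ _ _ _ D hD 𝒟 N M a S p mo' B' Φ hmax hN hwin hleaf hp hB hΦ hdev hsub hdis hcut
      hgap
    exact Summit.FinalStateConjecture.FinalStateConjecture.Theorems.stub_trivialRegime k k' ε Λ hkk'
      hΛε X D 𝒟 N M a S hleaf
  · have hεΛ : ε < Λ := lt_of_not_ge hΛε
    obtain ⟨δᵣ, γᵣ, hδᵣ, hγᵣ, hR'⟩ := hR Λ hΛ hεΛ
    rcases lt_or_ge Λ 1 with hΛ1 | hΛ1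
    · -- honest regime `ε < Λ < 1`
      obtain ⟨Λ₁, γ₄, hΛ₁, hγ₄, hW'⟩ := hW Λ hΛ1
      obtain ⟨γ₅, hγ₅, hP'⟩ := hP Λ₁ hΛ₁
      obtain ⟨δ₆, γ₆, hδ₆, hγ₆, hC'⟩ := hC Λ hΛ1 hεΛ
      set γs : ℝ := min (min γ₄ γ₅) (min γ₆ γᵣ) with hγs
      have hγs0 : 0 < γs := lt_min (lt_min hγ₄ hγ₅) (lt_min hγ₆ hγᵣ)
      have hγs₄ : γs ≤ γ₄ := (min_le_left _ _).trans (min_le_left _ _)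
      have hγs₅ : γs ≤ γ₅ := (min_le_left _ _).trans (min_le_right _ _)
      have hγs₆ : γs ≤ γ₆ := (min_le_right _ _).trans (min_le_left _ _)
      have hγsᵣ : γs ≤ γᵣ := (min_le_right _ _).trans (min_le_right _ _)
      set δ : ℝ≥0∞ := min δ₆ δᵣ with hδ
      have hδ0 : 0 < δ := lt_min hδ₆ hδᵣ
      have hδδ₆ : δ ≤ δ₆ := min_le_left _ _
      have hδδᵣ : δ ≤ δᵣ := min_le_right _ _
      refine ⟨δ, γs / 3, hδ0, by positivity, ?_⟩
      intro X _ _ _ _ _ _ D hD 𝒟 N M a S p mo' B' Φ hmax hN hwin hleaf hp hB hΦ hdev hsub hdis hcut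
        hgap
      -- monotonicity of the collar closeness in `k` and `δ`
      have hdev_of : ∀ {kk : ℕ} {dd : ℝ≥0∞}, kk ≤ k' → δ ≤ dd →
          ∀ i, 𝒟.toSpacetime.truncDeviationCk (B' i) (Φ i) kk (3 * M i) 0 ≤ dd := by
        intro kk dd hkk hdd i
        exact ((supCkENorm_mono_right _ hkk _).trans (hdev i)).trans hdd
      -- the gap clause in its definitional form, and its monotonicity in `γ`
      have hgap' : 𝒟.BondiBartnikGapLE ({p} ∪ ⋃ i, Φ i '' (B' i).truncTimeSlab (3 * M i) 0)
          (γs / 3) := hgap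
      have hγ3₆ : γs / 3 ≤ γ₆ := by linarith
      have hγ3ᵣ : γs / 3 ≤ γᵣ := by linarith
      -- case split on the number of holes
      rcases N with _ | _ | n
      · -- N = 0: THIS LINE
        have hC0 : ({p} ∪ ⋃ i, Φ i '' (B' i).truncTimeSlab (3 * M i) 0) = ({p} : Set 𝒟.carrier) := by
          simp
        rw [hC0] at hgap'
        -- B1: a competitor of mass ≤ γ⋆/3, hence an own cut energy ≤ γ⋆
        obtain ⟨m', hm', hm'le⟩ := stub_probeBartnikMassZero X D hD 𝒟 p hmax
          (hleaf.subset_causalFuture hp) (γs / 3) (by positivity)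
        obtain ⟨m, hm, hmle⟩ :=
          (VacuumCauchyDevelopment.bondiBartnikGapLE_iff.1 hgap') m' hm' (γs / 3) (by positivity)
        have hmγ : m ≤ γs := by linarith
        -- F3: the honest hyperboloid inside J⁺(p)
        obtain ⟨S₁, hS₁, hS₁p⟩ :=
          hW' X D hD 𝒟 M a S p m hmax (hleaf.mono hk₄ le_rfl) hp hm (hmγ.trans hγs₄)
        -- B2: the engine
        obtain ⟨S', hS', hS'S₁⟩ := hP' X D hD 𝒟 M a S₁ p m hmax hS₁ hS₁p hm (hmγ.trans hγs₅)
        refine ⟨S', hS', hS'S₁.trans ((LorentzianMetric.causalFuture_mono hS₁p).trans ?_)⟩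
        -- J⁺(J⁺ {p}) = J⁺ {p} ⊆ J⁺ S
        rw [LorentzianMetric.causalFuture_causalFuture_eq (WithTop.coe_le_coe.mpr le_top) ({p} : Set 𝒟.carrier)]
        exact LorentzianMetric.causalFuture_mono (singleton_subset_iff.2 hp)
      · -- N = 1: foreign collar sector, or residue when `p` is off the collar
        by_cases hpc : ∃ i, p ∈ Φ i '' (B' i).truncTimeSlab (3 * M i) 0
        · exact hC' X D hD 𝒟 M a S p mo' B' Φ hmax hwin (hleaf.mono hk₆ le_rfl) hp hpc hB hΦ
            (hdev_of hk₆ hδδ₆) hsub hcut (hgap'.mono hγ3₆)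
        · push Not at hpc
          exact hR' X D hD 𝒟 _ M a S p mo' B' Φ (Or.inr (Or.inr ⟨rfl, hpc⟩)) hmax hN hwin
            (hleaf.mono hkᵣ le_rfl) hp hB hΦ (hdev_of hkᵣ hδδᵣ) hsub hdis hcut (hgap'.mono hγ3ᵣ)
      · -- N ≥ 2: residue (seamed / stacked cores)
        exact hR' X D hD 𝒟 (n + 2) M a S p mo' B' Φ (Or.inr (Or.inl (by omega))) hmax hN hwin
          (hleaf.mono hkᵣ le_rfl) hp hB hΦ (hdev_of hkᵣ hδδᵣ) hsub hdis hcut (hgap'.mono hγ3ᵣ)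
    · -- junk-chart regime `1 ≤ Λ`: filed-text residue
      refine ⟨δᵣ, γᵣ, hδᵣ, hγᵣ, ?_⟩
      intro X _ _ _ _ _ _ D hD 𝒟 N M a S p mo' B' Φ hmax hN hwin hleaf hp hB hΦ hdev hsub hdis hcut
        hgap
      exact hR' X D hD 𝒟 N M a S p mo' B' Φ (Or.inl hΛ1) hmax hN hwin (hleaf.mono hkᵣ le_rfl) hp hB hΦ
        (fun i => (supCkENorm_mono_right _ hkᵣ _).trans (hdev i)) hsub hdis hcut hgap

end Summit.FinalStateConjecture.FinalStateConjecture.Cruxes.BondiBartnikRigidity.HyperboloidalMassPinchesFlat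

end
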